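import Summits.ResolutionOfSingularities.ResolutionOfSingularities.Theorems.ThreadCutLaw
import HarnessLib

/-!
# ThreadCutLaw2 — decomp-res node «ThreadCut» (lens-5 g31, critic row 198 CLEARED +1), tree file 2/4 of the node

Content VERBATIM from the decomp-res lens-5 g31 node `HOME/decomp-res-lens-5/g31/ThreadCut.lean` (pin 856c26bf; no
carry, imports the landed tree only); HOME = run/shared/lean/pub/decomp-res; critic row 198 CLEARED +1; landing plan
NODE-g31.md 442a09ac §7 + rider INBOX :1203 — provenance, critic text and the lens header in full in the first file
of the node, `ThreadCutLaw`.  Namespace `…Theorems.ThreadCut`; `--supports stmt-ResolutionOfSingularities-31770`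
unless said otherwise.

## This file

Continuation 2/2 of `ThreadCutLaw` (same sections of the node, cut at the 400-line cap; section variables / opens
replayed): carries `two_letter_eventually_heavy`, `Thread.eventually_offHeavy_of_twoChart_corner_tail`,
`Thread.no_light_io_twoChart_corner_tail`, `Thread.offHeavy_from`, `Thread.eventually_cruciform`,
`topIdeal_le_cross_of_cruciform`, `Thread.eventually_not_isolated_of_twoChart_corner_tail`,
`Thread.not_twoChart_corner_of_isolated_io`,
`_root_.Summit.ResolutionOfSingularities.ResolutionOfSingularities.Theorems.TightDefectClasses.ForcedWalk.no_twoChart_corner_tail'`.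

[WRITER NOTE (decomp-res writer g12): file split only (tree files ≤ 400 lines); namespace, sections, section
variables / opens and every declaration exactly as in the lens (the node's HOME-only dupNamespace-linter line is
dropped; the namespace-level `open` lines of the node are replayed in every part).]

(Sources: Hauser2010 §§F–G (kangaroo points, corner calculus); HauserPerlega2019 §2; Hironaka1967;
CossartJannsenSaito2020 Ch. 8; CossartPiltant2008 §2; CornerTowerDescent (lens-5 g13, tree); DeltaCutRun2 (lens-6 g25, tree).)
-/

open MvPolynomial
open Literature.AlgebraicGeometry.Resolution
open Literature.AlgebraicGeometry.Resolution.Hauser2010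
open Literature.AlgebraicGeometry.Resolution.PointBlowup
open Summit.ResolutionOfSingularities.ResolutionOfSingularities.Theorems.TightDefectClasses
open Summit.ResolutionOfSingularities.ResolutionOfSingularities.Theorems.CornerTowerDescent
open Summit.ResolutionOfSingularities.ResolutionOfSingularities.Theorems.LassoCut

namespace Summit.ResolutionOfSingularities.ResolutionOfSingularities.Theorems.ThreadCut

section CornerLaw

/-! ## §4 THE THREAD CORNER LAW (two charts): finitely many light steps -/

/-- **ABSTRACT TWO-LETTER DESCENT WITHOUT ISOLATION.**  Data as in `CornerTowerDescent.two_letter_descent` (finite sets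
`S i` moved by maps `φ i` playing letters `dir i ∈ {J, K}`, the chart laws for `deg` / `off`, deletions allowed but light
elements kept, all degrees `≥ n`) but WITHOUT the hypothesis that every step has a light element.  Conclusion: from some
stage on NO step has a light element (every element is heavy for the played letter).  Proof: the product potential
`Σ_{S i} π⁻ ∈ ℕ` (`π = ρ_J ρ_K`, `ρ = off − n`) never increases and drops at each light step. [folklore] (new here) -/
theorem two_letter_eventually_heavy {A L : Type} [DecidableEq A] [DecidableEq L] (n : ℕ) (deg : A → ℕ)
    (off : L → A → ℕ) (S : ℕ → Finset A) (φ : ℕ → A → A) (dir : ℕ → L) (J K : L) (hJK : J ≠ K)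
    (htwo : ∀ i, dir i = J ∨ dir i = K)
    (hsame : ∀ i a, off (dir i) (φ i a) = off (dir i) a)
    (hother : ∀ i a k, k ≠ dir i → n ≤ deg a → off k (φ i a) + n = off k a + off (dir i) a)
    (hdeg : ∀ i a, n ≤ deg a → deg (φ i a) + n = deg a + off (dir i) a)
    (hS : ∀ i, S (i + 1) ⊆ (S i).image (φ i))
    (hkeep : ∀ i, ∀ a ∈ S i, off (dir i) a < n → φ i a ∈ S (i + 1))
    (hle : ∀ i, ∀ a ∈ S i, n ≤ deg a) :
    ∃ N, ∀ i, N ≤ i → ∀ a ∈ S i, n ≤ off (dir i) a := by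
  classical
  have hKJ : ∀ i, (dir i = J ∧ K ≠ dir i) ∨ (dir i = K ∧ J ≠ dir i) := fun i => by
    rcases htwo i with h | h
    · exact Or.inl ⟨h, by rw [h]; exact hJK.symm⟩
    · exact Or.inr ⟨h, by rw [h]; exact hJK⟩
  -- (1) no doubly light element: it would keep losing degree
  have hDL : ∀ i, ∀ a ∈ S i, off J a < n → off K a < n → False := by
    intro i a ha hJ hK
    have desc : ∀ m, ∃ b ∈ S (i + m), off J b < n ∧ off K b < n ∧ deg b + m ≤ deg a := by
      intro m
      induction m with
      | zero => exact ⟨a, ha, hJ, hK, le_rfl⟩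
      | succ m ih =>
        obtain ⟨b, hb, hbJ, hbK, hbd⟩ := ih
        have hbdir : off (dir (i + m)) b < n := by
          rcases htwo (i + m) with h | h
          · rw [h]; exact hbJ
          · rw [h]; exact hbK
        have hnb := hle _ b hb
        have hd := hdeg (i + m) b hnb
        refine ⟨φ (i + m) b, hkeep _ b hb hbdir, ?_, ?_, by omega⟩
        · rcases hKJ (i + m) with ⟨hd', hne⟩ | ⟨hd', hne⟩
          · have h1 := hsame (i + m) b
            rw [hd'] at h1
            omega
          · have h1 := hother (i + m) b J hne hnb
            rw [hd'] at h1
            omega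
        · rcases hKJ (i + m) with ⟨hd', hne⟩ | ⟨hd', hne⟩
          · have h1 := hother (i + m) b K hne hnb
            rw [hd'] at h1
            omega
          · have h1 := hsame (i + m) b
            rw [hd'] at h1
            omega
    obtain ⟨b, -, -, -, hbd⟩ := desc (deg a + 1)
    omega
  -- (2) the potential never increases on any element …
  have hstep : ∀ i, ∀ a ∈ S i,
      twoPot ((off J (φ i a) : ℤ) - n) ((off K (φ i a) : ℤ) - n) ≤
        twoPot ((off J a : ℤ) - n) ((off K a : ℤ) - n) := by
    intro i a ha
    have hna := hle i a ha
    rcases hKJ i with ⟨hd, hne⟩ | ⟨hd, hne⟩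
    · have h1 := hsame i a
      have h2 := hother i a K hne hna
      rw [hd] at h1 h2
      have h2' : ((off K (φ i a) : ℕ) : ℤ) - n = ((off K a : ℤ) - n) + ((off J a : ℤ) - n) := by
        have := congrArg (Nat.cast (R := ℤ)) h2
        push_cast at this
        linarith
      rw [h1, h2']
      exact twoPot_step_le _ _
    · have h1 := hsame i a
      have h2 := hother i a J hne hna
      rw [hd] at h1 h2
      have h2' : ((off J (φ i a) : ℕ) : ℤ) - n = ((off J a : ℤ) - n) + ((off K a : ℤ) - n) := by
        have := congrArg (Nat.cast (R := ℤ)) h2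
        push_cast at this
        linarith
      rw [h1, h2', twoPot_comm, twoPot_comm ((off J a : ℤ) - n)]
      exact twoPot_step_le _ _
  -- … and drops by one on a light element
  have hwit : ∀ i, ∀ a ∈ S i, off (dir i) a < n →
      twoPot ((off J (φ i a) : ℤ) - n) ((off K (φ i a) : ℤ) - n) + 1 ≤
        twoPot ((off J a : ℤ) - n) ((off K a : ℤ) - n) := by
    intro i a ha hlow
    have hna := hle i a ha
    have hka := hkeep i a ha hlow
    rcases hKJ i with ⟨hd, hne⟩ | ⟨hd, hne⟩
    · have h1 := hsame i a
      have h2 := hother i a K hne hna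
      rw [hd] at h1 h2 hlow
      have hK' : ¬ off K (φ i a) < n := fun h => hDL (i + 1) _ hka (by rw [h1]; exact hlow) h
      have h2' : ((off K (φ i a) : ℕ) : ℤ) - n = ((off K a : ℤ) - n) + ((off J a : ℤ) - n) := by
        have := congrArg (Nat.cast (R := ℤ)) h2
        push_cast at this
        linarith
      rw [h1, h2']
      exact twoPot_step_lt _ _ (by have := hlow; omega) (by push Not at hK'; have := hK'; omega)
    · have h1 := hsame i a
      have h2 := hother i a J hne hna
      rw [hd] at h1 h2 hlow
      have hJ' : ¬ off J (φ i a) < n := fun h => hDL (i + 1) _ hka h (by rw [h1]; exact hlow)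
      have h2' : ((off J (φ i a) : ℕ) : ℤ) - n = ((off J a : ℤ) - n) + ((off K a : ℤ) - n) := by
        have := congrArg (Nat.cast (R := ℤ)) h2
        push_cast at this
        linarith
      rw [h1, h2', twoPot_comm, twoPot_comm ((off J a : ℤ) - n)]
      exact twoPot_step_lt _ _ (by have := hlow; omega) (by push Not at hJ'; have := hJ'; omega)
  -- (3) the sum `V i ∈ ℕ` is non-increasing, and strictly decreasing at a light step
  set V : ℕ → ℤ := fun i => ∑ a ∈ S i, twoPot ((off J a : ℤ) - n) ((off K a : ℤ) - n) with hV
  have hV0 : ∀ i, 0 ≤ V i := fun i => Finset.sum_nonneg fun a _ => twoPot_nonneg _ _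
  have hVle : ∀ i, V (i + 1) ≤ V i := by
    intro i
    calc V (i + 1) ≤ ∑ a ∈ (S i).image (φ i), twoPot ((off J a : ℤ) - n) ((off K a : ℤ) - n) :=
          Finset.sum_le_sum_of_subset_of_nonneg (hS i) fun a _ _ => twoPot_nonneg _ _
      _ ≤ ∑ a ∈ S i, twoPot ((off J (φ i a) : ℤ) - n) ((off K (φ i a) : ℤ) - n) :=
          Finset.sum_image_le_of_nonneg fun a _ => twoPot_nonneg _ _
      _ ≤ V i := Finset.sum_le_sum fun a ha => hstep i a ha
  have hVlt : ∀ i, (∃ a ∈ S i, off (dir i) a < n) → V (i + 1) < V i := by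
    rintro i ⟨a, ha, hlow⟩
    calc V (i + 1) ≤ ∑ a ∈ (S i).image (φ i), twoPot ((off J a : ℤ) - n) ((off K a : ℤ) - n) :=
          Finset.sum_le_sum_of_subset_of_nonneg (hS i) fun a _ _ => twoPot_nonneg _ _
      _ ≤ ∑ a ∈ S i, twoPot ((off J (φ i a) : ℤ) - n) ((off K (φ i a) : ℤ) - n) :=
          Finset.sum_image_le_of_nonneg fun a _ => twoPot_nonneg _ _
      _ < V i := Finset.sum_lt_sum (fun a ha => hstep i a ha) ⟨a, ha, by have := hwit i a ha hlow; omega⟩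
  -- (4) finitely many light steps: induction on the value of the potential
  have key : ∀ v : ℕ, ∀ i₀, V i₀ ≤ v → ∃ N, ∀ i, N ≤ i → ∀ a ∈ S i, n ≤ off (dir i) a := by
    intro v
    induction v with
    | zero =>
      intro i₀ hi₀
      refine ⟨i₀, fun i hi a ha => ?_⟩
      by_contra hlt
      have hmono : ∀ m, V (i₀ + m) ≤ V i₀ := by
        intro m
        induction m with
        | zero => exact le_rfl
        | succ m ih => exact le_trans (by rw [← Nat.add_assoc]; exact hVle _) ih
      have h1 := hVlt i ⟨a, ha, not_le.mp hlt⟩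
      have h2 := hmono (i - i₀)
      rw [Nat.add_sub_cancel' hi] at h2
      have h3 := hV0 (i + 1)
      push_cast at hi₀
      omega
    | succ v ih =>
      intro i₀ hi₀
      by_cases h : ∃ i, i₀ ≤ i ∧ ∃ a ∈ S i, off (dir i) a < n
      · obtain ⟨i, hi, hl⟩ := h
        have hmono : ∀ m, V (i₀ + m) ≤ V i₀ := by
          intro m
          induction m with
          | zero => exact le_rfl
          | succ m ih' => exact le_trans (by rw [← Nat.add_assoc]; exact hVle _) ih'
        have h2 := hmono (i - i₀)
        rw [Nat.add_sub_cancel' hi] at h2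
        have h1 := hVlt i hl
        exact ih (i + 1) (by push_cast at hi₀ ⊢; omega)
      · push Not at h
        exact ⟨i₀, fun i hi a ha => h i hi a ha⟩
  exact key (V 0).toNat 0 (by rw [Int.toNat_of_nonneg (hV0 0)])

variable {K : Type} [Field K] [DecidableEq K] {q : ℕ} {s₀ : State (Fin 3) K}

/-- **THREAD CORNER LAW** (KERNEL, every `q`, every field): a thread that passes, from time `T₀` on, through CORNER
points only (`b = 0`) while avoiding one chart `u_l` is EVENTUALLY AXIAL — from some time on every stage is off-heavy for
the chart played there (the played axis is a top line through the thread point).  [DECIDED — PROVED here, by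
`two_letter_eventually_heavy`] (Sources: Hauser2010, §F.) -/
theorem Thread.eventually_offHeavy_of_twoChart_corner_tail (T : Thread q s₀) (l : Fin 3) (T₀ : ℕ)
    (hrec : T.TwoChartCornerTailFrom l T₀) :
    ∃ N, ∀ t, N ≤ t → OffHeavy q (T.j (t + 1)) (T.st (t + 1)).F := by
  classical
  have H : ∃ N, ∀ i, N ≤ i → ∀ a ∈ (T.st (T₀ + i + 1)).F.support, q ≤ a.degree - a (T.j (T₀ + i + 1)) := by
    refine two_letter_eventually_heavy (A := Fin 3 →₀ ℕ) (L := Fin 3) q (fun m => m.degree)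
      (fun k m => m.degree - m k) (fun i => (T.st (T₀ + i + 1)).F.support) (fun i => chartExponent q (T.j (T₀ + i + 1)))
      (fun i => T.j (T₀ + i + 1)) (l + 1) (l + 2) (fin3_succ_ne_succ_succ l)
      (fun i => fin3_eq_or_of_ne l _ (hrec (T₀ + i) (Nat.le_add_right _ _)).2)
      (fun i m => offDegree_chartExponent q _ m) ?_ ?_ ?_ ?_ ?_
    · intro i m k hk hq
      exact offDegree_chartExponent_of_ne q hk m hq
    · intro i m hq
      rw [degree_chartExponent]
      have h2 : m (T.j (T₀ + i + 1)) ≤ m.degree := by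
        rw [degree_eq_add_sum_erase (T.j (T₀ + i + 1)) m]; exact Nat.le_add_right _ _
      omega
    · intro i
      exact T.support_succ_subset_image (T₀ + i) (hrec (T₀ + i) (Nat.le_add_right _ _)).1
    · intro i m hm hlow
      exact (T.low_monomial_transport rfl (hrec (T₀ + i) (Nat.le_add_right _ _)).1 hm hlow).1
    · intro i m hm
      exact T.le_degree_of_mem_support_succ (T₀ + i) hm
  obtain ⟨N, hN⟩ := H
  refine ⟨T₀ + N, fun t ht m hm => ?_⟩
  obtain ⟨i, rfl⟩ : ∃ i, t = T₀ + i := ⟨t - T₀, by omega⟩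
  exact hN i (by omega) m hm

/-- THE EMPTY CELL of the kind: no two-chart corner thread has INFINITELY MANY LIGHT (non-axial) steps.
[DECIDED — PROVED here] (Sources: Hauser2010, §F.) -/
theorem Thread.no_light_io_twoChart_corner_tail (T : Thread q s₀) (l : Fin 3) (T₀ : ℕ)
    (hrec : T.TwoChartCornerTailFrom l T₀) (hlight : ∀ N, ∃ t, N ≤ t ∧ ¬ OffHeavy q (T.j (t + 1)) (T.st (t + 1)).F) :
    False := by
  obtain ⟨N, hN⟩ := T.eventually_offHeavy_of_twoChart_corner_tail l T₀ hrec
  obtain ⟨t, ht, hl⟩ := hlight N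
  exact hl (hN t ht)

/-- … once axial for a chart `u_k` at a late stage, axial for `u_k` forever (heaviness transport along the axial tail).
[folklore] -/
theorem Thread.offHeavy_from (T : Thread q s₀) (l : Fin 3) (T₀ N : ℕ) (hrec : T.TwoChartCornerTailFrom l T₀)
    (hN : ∀ t, N ≤ t → OffHeavy q (T.j (t + 1)) (T.st (t + 1)).F) {k : Fin 3} {t₁ : ℕ} (ht₁ : max T₀ N ≤ t₁)
    (hk : OffHeavy q k (T.st (t₁ + 1)).F) : ∀ t, t₁ ≤ t → OffHeavy q k (T.st (t + 1)).F := by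
  intro t ht
  induction t, ht using Nat.le_induction with
  | base => exact hk
  | succ t ht ih =>
    exact T.offHeavy_succ t (hrec t (by omega)).1 (hN t (by omega)) ih

/-- **CRUCIFORM LAW**: if both remaining charts recur, the thread is EVENTUALLY CRUCIFORM — axial for BOTH, so the
thread point is the CROSSING of two top lines (P∞'s `L_s ∪ L_w`). [DECIDED — PROVED here] (Sources: Hauser2010, §F.) -/
theorem Thread.eventually_cruciform (T : Thread q s₀) (l : Fin 3) (T₀ : ℕ) (hrec : T.TwoChartCornerTailFrom l T₀)
    (hJ : ∀ N, ∃ t, N ≤ t ∧ T.j (t + 1) = l + 1) (hK : ∀ N, ∃ t, N ≤ t ∧ T.j (t + 1) = l + 2) :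
    ∃ N, ∀ t, N ≤ t → OffHeavy q (l + 1) (T.st (t + 1)).F ∧ OffHeavy q (l + 2) (T.st (t + 1)).F := by
  obtain ⟨N, hN⟩ := T.eventually_offHeavy_of_twoChart_corner_tail l T₀ hrec
  obtain ⟨t₁, ht₁, hj₁⟩ := hJ (max T₀ N)
  have h1 : OffHeavy q (l + 1) (T.st (t₁ + 1)).F := by rw [← hj₁]; exact hN t₁ (le_trans (le_max_right _ _) ht₁)
  have hJ' := T.offHeavy_from l T₀ N hrec hN ht₁ h1
  obtain ⟨t₂, ht₂, hj₂⟩ := hK (max (max T₀ N) t₁)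
  have h2 : OffHeavy q (l + 2) (T.st (t₂ + 1)).F := by
    rw [← hj₂]; exact hN t₂ (le_trans (le_max_right _ _) (le_trans (le_max_left _ _) ht₂))
  have hK' := T.offHeavy_from l T₀ N hrec hN (le_trans (le_max_left _ _) ht₂) h2
  exact ⟨t₂, fun t ht => ⟨hJ' t (le_trans (le_max_right _ _) (le_trans ht₂ ht)), hK' t ht⟩⟩

omit [DecidableEq K] in
/-- … and the top ideal of a cruciform stage lies in BOTH axis ideals: two top lines cross at the thread point.
[folklore] -/
theorem topIdeal_le_cross_of_cruciform {J K' : Fin 3} {F : MvPolynomial (Fin 3) K} (hJ : OffHeavy q J F)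
    (hK : OffHeavy q K' F) :
    topIdeal q F ≤ Ideal.span (MvPolynomial.X '' {i : Fin 3 | i ≠ J}) ⊓
      Ideal.span (MvPolynomial.X '' {i : Fin 3 | i ≠ K'}) :=
  le_inf (topIdeal_le_axis_of_offHeavy hJ) (topIdeal_le_axis_of_offHeavy hK)

/-- A two-chart corner thread is EVENTUALLY NON-ISOLATED: from some stage on the top point is not isolated (the model
shadow of §7's scheme kind). [DECIDED — PROVED here] (Sources: Hauser2010, §F.) -/
theorem Thread.eventually_not_isolated_of_twoChart_corner_tail (T : Thread q s₀) (l : Fin 3) (T₀ : ℕ)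
    (hrec : T.TwoChartCornerTailFrom l T₀) : ∃ N, ∀ t, N ≤ t → ¬ IsolatedTop q (T.st (t + 1)).F := by
  obtain ⟨N, hN⟩ := T.eventually_offHeavy_of_twoChart_corner_tail l T₀ hrec
  exact ⟨N, fun t ht => not_isolatedTop_of_offHeavy (hN t ht)⟩

/-- CONTRAPOSITIVE (the Iso side of §7 contains no two-chart corner thread of the model): a thread whose top point is
isolated infinitely often is NOT a two-chart corner tail. [DECIDED — PROVED here] (Sources: Hauser2010, §F.) -/
theorem Thread.not_twoChart_corner_of_isolated_io (T : Thread q s₀)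
    (hiso : ∀ N, ∃ t, N ≤ t ∧ IsolatedTop q (T.st (t + 1)).F) (l : Fin 3) (T₀ : ℕ) :
    ¬ T.TwoChartCornerTailFrom l T₀ := by
  intro hrec
  obtain ⟨N, hN⟩ := T.eventually_not_isolated_of_twoChart_corner_tail l T₀ hrec
  obtain ⟨t, ht, hi⟩ := hiso N
  exact hN t ht hi

/-- RECOVERY: the tree's forced-walk cell `LassoCut.no_twoChart_corner_tail` is «thread corner law + isolation».
[folklore] -/
theorem _root_.Summit.ResolutionOfSingularities.ResolutionOfSingularities.Theorems.TightDefectClasses.ForcedWalk.no_twoChart_corner_tail'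
    (W : ForcedWalk q s₀) (l : Fin 3) (T₀ : ℕ) (hrec : ∀ t, T₀ ≤ t → W.b (t + 1) = 0 ∧ W.j (t + 1) ≠ l) : False := by
  obtain ⟨N, hN⟩ := W.toThread.eventually_offHeavy_of_twoChart_corner_tail l T₀ hrec
  exact not_isolatedTop_of_offHeavy (hN N le_rfl) (W.isolated (N + 1))

end CornerLaw

end Summit.ResolutionOfSingularities.ResolutionOfSingularities.Theorems.ThreadCut
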